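import Summits.MatrixMultiplication.MatrixMultiplication.Theses.ThinBlockAlpha

set_option linter.dupNamespace false  -- `Summit.<S>.<S>.…` is the mandated namespace (lakefile does the same)

/-!
# Targets: necessary conditions on witnesses of `stub_multiRadiusFrames` (`MultiRadiusFrameDesigns`)

The registered hardest stub of the picked line `label-weighted-stpp-debordering` asks, for every
`a < 1`, `η > 0`, for frame families `A B C : Fin L → Finset (Fin D → ℤ)` in the box `[-b, b]^D`
with blocks `⟨N, M, N⟩`, the tile packing `c − a = c' − a' → (i,a,c) = (k,a',c')` and the host
count `(6b+1)^D ≤ L·N^{2+η}`.  Using ONLY these three clauses: the `L·N²` tiles `c − a` are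
distinct points of `[-2b, 2b]^D`, so `L·N² ≤ (4b+1)^D` and `(6b+1)^D ≤ (4b+1)^D·N^η`; as
`(6b+1)/(4b+1) ≥ 7/5` (`b ≥ 1` is forced by `N ≥ 2`), every witness has `N^η ≥ (7/5)^D`
(drefute's necessary condition (ii), made a theorem): the slack is exponential in the dimension,
boxes of side `b` can only serve `η ≥ 2·log(7/5)/log(2b+1)`-ish since `N ≤ (2b+1)^D`.
-/

namespace Summit.MatrixMultiplication.MatrixMultiplication.Theorems.ThinPackings.Negative

open Finset

/-- **Tiles live in the doubled box.**  Frame-stub clauses (tile packing + box) force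
`L·N² ≤ (4b+1)^D`. [new, elementary] -/
theorem frames_tiles_le_box {D L b N : ℕ} {A C : Fin L → Finset (Fin D → ℤ)}
    (hpack : ∀ i k, ∀ a ∈ A i, ∀ c ∈ C i, ∀ a' ∈ A k, ∀ c' ∈ C k,
      c - a = c' - a' → i = k ∧ a = a' ∧ c = c')
    (hboxA : ∀ i, ∀ v ∈ A i, ∀ t, |v t| ≤ (b : ℤ)) (hboxC : ∀ i, ∀ v ∈ C i, ∀ t, |v t| ≤ (b : ℤ))
    (hcA : ∀ i, (A i).card = N) (hcC : ∀ i, (C i).card = N) :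
    L * N ^ 2 ≤ (4 * b + 1) ^ D := by
  classical
  set S : Finset (Σ _ : Fin L, (Fin D → ℤ) × (Fin D → ℤ)) := univ.sigma fun i => A i ×ˢ C i
    with hS
  set Box : Finset (Fin D → ℤ) := Fintype.piFinset fun _ => Icc (-(2 * b : ℤ)) (2 * b) with hBox
  set f : (Σ _ : Fin L, (Fin D → ℤ) × (Fin D → ℤ)) → (Fin D → ℤ) := fun x => x.2.2 - x.2.1 with hf
  have hcardS : S.card = L * N ^ 2 := by
    rw [hS, card_sigma]
    simp only [card_product, hcA, hcC, sum_const, card_univ, Fintype.card_fin, smul_eq_mul]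
    ring
  have hinj : Set.InjOn f ↑S := by
    rintro ⟨i, a, c⟩ hx ⟨k, a', c'⟩ hy he
    simp only [hS, coe_sigma, Set.mem_sigma_iff, coe_univ, Set.mem_univ, true_and, coe_product,
      Set.mem_prod, mem_coe] at hx hy
    change c - a = c' - a' at he
    obtain ⟨rfl, rfl, rfl⟩ := hpack i k a hx.1 c hx.2 a' hy.1 c' hy.2 he
    rfl
  have himg : S.image f ⊆ Box := by
    intro v hv
    rw [mem_image] at hv
    obtain ⟨⟨i, a, c⟩, hx, rfl⟩ := hv
    simp only [hS, mem_sigma, mem_univ, true_and, mem_product] at hx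
    rw [hBox, Fintype.mem_piFinset]
    intro t
    have ha := hboxA i a hx.1 t
    have hc := hboxC i c hx.2 t
    rw [abs_le] at ha hc
    simp only [hf, Pi.sub_apply, mem_Icc]
    constructor <;> linarith [ha.1, ha.2, hc.1, hc.2]
  have hcardBox : Box.card = (4 * b + 1) ^ D := by
    rw [hBox, Fintype.card_piFinset, prod_const, card_univ, Fintype.card_fin, Int.card_Icc]
    congr 1
    omega
  calc L * N ^ 2 = S.card := hcardS.symm
    _ = (S.image f).card := (card_image_of_injOn hinj).symm
    _ ≤ Box.card := card_le_card himg
    _ = (4 * b + 1) ^ D := hcardBox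

/-- **Slack is exponential in the dimension.**  With the host count `(6b+1)^D ≤ L·N^{2+η}` of
the stub added: `(6b+1)^D ≤ (4b+1)^D · N^η`, `b ≥ 1`, and `(7/5)^D ≤ N^η`. [new, elementary] -/
theorem frames_slack_lower_bound {D L b N : ℕ} {A C : Fin L → Finset (Fin D → ℤ)} {η : ℝ}
    (hpack : ∀ i k, ∀ a ∈ A i, ∀ c ∈ C i, ∀ a' ∈ A k, ∀ c' ∈ C k,
      c - a = c' - a' → i = k ∧ a = a' ∧ c = c')
    (hboxA : ∀ i, ∀ v ∈ A i, ∀ t, |v t| ≤ (b : ℤ)) (hboxC : ∀ i, ∀ v ∈ C i, ∀ t, |v t| ≤ (b : ℤ))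
    (hcA : ∀ i, (A i).card = N) (hcC : ∀ i, (C i).card = N) (hN : 2 ≤ N)
    (hhost : (((6 * b + 1 : ℕ) : ℝ)) ^ D ≤ L * (N : ℝ) ^ (2 + η)) :
    (((6 * b + 1 : ℕ) : ℝ)) ^ D ≤ (((4 * b + 1 : ℕ) : ℝ)) ^ D * (N : ℝ) ^ η ∧ 1 ≤ b ∧
      ((7 : ℝ) / 5) ^ D ≤ (N : ℝ) ^ η := by
  have htiles := frames_tiles_le_box hpack hboxA hboxC hcA hcC
  have hNpos : (0 : ℝ) < N := by exact_mod_cast (by omega : 0 < N)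
  have htilesR : (L : ℝ) * (N : ℝ) ^ 2 ≤ (((4 * b + 1 : ℕ) : ℝ)) ^ D := by exact_mod_cast htiles
  have h1 : (((6 * b + 1 : ℕ) : ℝ)) ^ D ≤ (((4 * b + 1 : ℕ) : ℝ)) ^ D * (N : ℝ) ^ η := by
    calc (((6 * b + 1 : ℕ) : ℝ)) ^ D ≤ L * (N : ℝ) ^ (2 + η) := hhost
      _ = (L * (N : ℝ) ^ 2) * (N : ℝ) ^ η := by
          rw [Real.rpow_add hNpos, Real.rpow_two]; ring
      _ ≤ (((4 * b + 1 : ℕ) : ℝ)) ^ D * (N : ℝ) ^ η := by gcongr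
  -- `b ≥ 1`: in the box `[0,0]^D` a leg has at most one point
  have hb : 1 ≤ b := by
    by_contra hb0
    have hb0 : b = 0 := by omega
    subst hb0
    -- L ≥ 1 from the host inequality, then L N² ≤ 1 contradicts N ≥ 2
    have hL : 1 ≤ L := by
      by_contra hL0
      have hL0 : L = 0 := by omega
      rw [hL0, Nat.cast_zero, zero_mul] at hhost
      have : (0 : ℝ) < (((6 * 0 + 1 : ℕ) : ℝ)) ^ D := by positivity
      linarith
    have h4 : 1 * 2 ^ 2 ≤ L * N ^ 2 := Nat.mul_le_mul hL (Nat.pow_le_pow_left hN 2)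
    have h5 : (4 * 0 + 1) ^ D = 1 := by simp
    omega
  refine ⟨h1, hb, ?_⟩
  -- `(7/5)^D ≤ ((6b+1)/(4b+1))^D ≤ N^η`
  have h45pos : (0 : ℝ) < (((4 * b + 1 : ℕ) : ℝ)) ^ D := by positivity
  have hratio : (7 : ℝ) / 5 ≤ ((6 * b + 1 : ℕ) : ℝ) / ((4 * b + 1 : ℕ) : ℝ) := by
    rw [div_le_div_iff₀ (by norm_num) (by positivity)]
    push_cast
    have : (1 : ℝ) ≤ b := by exact_mod_cast hb
    nlinarith
  calc ((7 : ℝ) / 5) ^ D ≤ (((6 * b + 1 : ℕ) : ℝ) / ((4 * b + 1 : ℕ) : ℝ)) ^ D :=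
        pow_le_pow_left₀ (by norm_num) hratio D
    _ = (((6 * b + 1 : ℕ) : ℝ)) ^ D / (((4 * b + 1 : ℕ) : ℝ)) ^ D := div_pow _ _ _
    _ ≤ (N : ℝ) ^ η := by rw [div_le_iff₀ h45pos]; linarith [h1]

end Summit.MatrixMultiplication.MatrixMultiplication.Theorems.ThinPackings.Negative
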